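import Summits.Schanuel.Schanuel.Theses.RigidCore
import Literature.NumberTheory.Transcendental.ExpPointsExamples

/-!
# The three atoms are instances of the crux (`SparsityTwo → Aᵢ`): the promotion is lossless (lead c2)

Line `cusp-germ-schneider-sparsity` of the crux `RigidCore.SparsityTwo` (item stmt-Schanuel-0971). Together with
`sparsityTwo_of_atoms : A3 → A2 → A1 → SparsityTwo` (`RigidCoreSparsityTwoOfAtoms`) this file makes the reduction an
EQUIVALENCE in the tree: each registered atom (A3 `stub_wildCuspAtom`, A2 `stub_inhomogeneousCuspAtom`, A1 `stub_linearCuspAtom`,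
statements verbatim) FOLLOWS from the crux, hence from SC(2) (`Disproof.sparsityTwo_of_schanuelRank_two`) — so no atom can be
refuted without refuting Schanuel's conjecture, and promoting the atoms to items loses nothing.

Proof (`rayHits_finite_of_sparsityTwo`, the only content; the atom wrappers discard every other hypothesis): the atoms carry a
`ℚ`-curve `W'` (`IsDefinedOver ⊥`, `zariskiDim < 2`) containing the `t`-branch `((t⁻ᵉ, Φ₁ t/t^{N₀}), (e^{ℓ₀ t}, e^{ℓ₁ t}))`, and the
linking identities say that the ray point `x n = (2πi n + ℓu σₙ, 2πi (A(w n) + g σₙ) + ℓv σₙ)` (`σₙ = (w n)⁻¹`, `(w n)^e = n`) IS the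
branch point at `t = T σₙ`; at a hit (`A(w n) + g σₙ = L ∈ ℤ`) its exponential is `(e^{ℓ₀ (T σₙ)}, e^{ℓ₁ (T σₙ)})` because
`e^{2πi n} = e^{2πi L} = 1`. So every late independent hit is an independent exponential point of `W'`, a finite set by the crux;
and a finite set of points has bounded first coordinate while `‖x n 0‖ ≥ 2π n - (‖ℓu 0‖ + 1)`, so the late hits are bounded.
No unproved facts; axioms standard.
-/

set_option linter.dupNamespace false

namespace Summit.Schanuel.Schanuel.Cruxes.SparsityTwo.CuspGermSchneiderSparsity

open Filter Topology Complex Polynomial Literature.NumberTheory.Transcendental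
open scoped Real


/-- The ray abscissa `w N = N^{1/e}` satisfies `(w N)^e = N` (private copy of `rayAbscissa_pow`, kept here so that this
certificate does not wait for the hub build of `RigidCoreSparsityTwoSplitLemmas`). [folklore] -/
private theorem aoc_rayAbscissa_pow {e : ℕ} (he : 0 < e) (N : ℕ) :
    ((((N : ℝ) ^ ((e : ℝ)⁻¹) : ℝ) : ℂ)) ^ e = (N : ℂ) := by
  rw [← Complex.ofReal_pow, Real.rpow_inv_natCast_pow (Nat.cast_nonneg N) he.ne']
  simp

/-- The ray points `σ_N = (N^{1/e})⁻¹` tend to `0` within `{0}ᶜ` (private copy of `tendsto_rayPoint_nhdsNE`). [folklore] -/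
private theorem aoc_tendsto_rayPoint_nhdsNE {e : ℕ} (he : 0 < e) :
    Tendsto (fun N : ℕ => ((((N : ℝ) ^ ((e : ℝ)⁻¹) : ℝ) : ℂ))⁻¹) atTop (𝓝[≠] 0) := by
  have hpos : (0 : ℝ) < (e : ℝ)⁻¹ := inv_pos.mpr (by exact_mod_cast he)
  have h1 : Tendsto (fun N : ℕ => (N : ℝ) ^ ((e : ℝ)⁻¹)) atTop atTop :=
    (tendsto_rpow_atTop hpos).comp tendsto_natCast_atTop_atTop
  have h2 : Tendsto (fun N : ℕ => ((((N : ℝ) ^ ((e : ℝ)⁻¹) : ℝ) : ℂ))⁻¹) atTop (𝓝 0) := by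
    have h3 := (Complex.continuous_ofReal.tendsto 0).comp h1.inv_tendsto_atTop
    rw [Complex.ofReal_zero] at h3
    refine Tendsto.congr (fun N => ?_) h3
    simp only [Function.comp_apply, Pi.inv_apply, Complex.ofReal_inv]
  refine tendsto_nhdsWithin_iff.mpr ⟨h2, ?_⟩
  filter_upwards [eventually_gt_atTop 0] with N hN
  exact inv_ne_zero
    (Complex.ofReal_ne_zero.mpr (Real.rpow_pos_of_pos (Nat.cast_pos.mpr hN) _).ne')

/-- The ray points eventually lie in every punctured disc (private copy of `eventually_rayPoint_mem_puncturedDisc`).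
[folklore] -/
private theorem aoc_eventually_rayPoint_mem_puncturedDisc {e : ℕ} (he : 0 < e) {ρ : ℝ} (hρ : 0 < ρ) :
    ∀ᶠ N : ℕ in atTop, 0 < ‖((((N : ℝ) ^ ((e : ℝ)⁻¹) : ℝ) : ℂ))⁻¹‖ ∧
      ‖((((N : ℝ) ^ ((e : ℝ)⁻¹) : ℝ) : ℂ))⁻¹‖ < ρ := by
  have hmem : {σ : ℂ | 0 < ‖σ‖ ∧ ‖σ‖ < ρ} ∈ 𝓝[≠] (0 : ℂ) := by
    have h1 : Metric.ball (0 : ℂ) ρ ∈ 𝓝 (0 : ℂ) := Metric.ball_mem_nhds 0 hρ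
    have h2 : {σ : ℂ | σ ≠ 0} ∈ 𝓝[≠] (0 : ℂ) := self_mem_nhdsWithin
    filter_upwards [mem_nhdsWithin_of_mem_nhds h1, h2] with σ hσ hσ0
    exact ⟨norm_pos_iff.mpr hσ0, by simpa using hσ⟩
  exact (aoc_tendsto_rayPoint_nhdsNE he).eventually hmem

/-- **Ray hits at a uniformised cusp lying on a `ℚ`-curve are finite, given the crux.** See the module docstring. -/
theorem rayHits_finite_of_sparsityTwo (hcrux : Summit.Schanuel.Schanuel.Theses.RigidCore.SparsityTwo)
    {e N₀ : ℕ} {A : Polynomial ℂ} {g ℓu ℓv T ℓ₀ ℓ₁ Φ₁ : ℂ → ℂ} {ρ r : ℝ} (he : 0 < e) (hρ : 0 < ρ)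
    (hu : AnalyticAt ℂ ℓu 0)
    (hlink : ∀ σ : ℂ, 0 < ‖σ‖ → ‖σ‖ < ρ → 0 < ‖T σ‖ ∧ ‖T σ‖ < r ∧
      ((T σ) ^ e)⁻¹ = 2 * ↑π * I * σ⁻¹ ^ e + ℓu σ ∧
      Φ₁ (T σ) / (T σ) ^ N₀ = 2 * ↑π * I * (A.eval σ⁻¹ + g σ) + ℓv σ ∧
      ℓ₀ (T σ) = ℓu σ ∧ ℓ₁ (T σ) = ℓv σ)
    (hW' : ∃ W' : Set (Fin 2 ⊕ Fin 2 → ℂ), IsDefinedOver (⊥ : Subfield ℂ) W' ∧ zariskiDim ℂ W' < 2 ∧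
      ∀ t : ℂ, 0 < ‖t‖ → ‖t‖ < r →
        Sum.elim (![(t ^ e)⁻¹, Φ₁ t / t ^ N₀] : Fin 2 → ℂ)
          (![Complex.exp (ℓ₀ t), Complex.exp (ℓ₁ t)] : Fin 2 → ℂ) ∈ W') :
    Set.Finite {n : ℕ |
      LinearIndependent ℚ (![2 * ↑π * I * (n : ℂ) + ℓu ((((n : ℝ) ^ ((e : ℝ)⁻¹) : ℝ) : ℂ))⁻¹,
        2 * ↑π * I * (A.eval ((((n : ℝ) ^ ((e : ℝ)⁻¹) : ℝ) : ℂ)) +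
          g ((((n : ℝ) ^ ((e : ℝ)⁻¹) : ℝ) : ℂ))⁻¹) + ℓv ((((n : ℝ) ^ ((e : ℝ)⁻¹) : ℝ) : ℂ))⁻¹] : Fin 2 → ℂ) ∧
      ∃ L : ℤ, A.eval ((((n : ℝ) ^ ((e : ℝ)⁻¹) : ℝ) : ℂ)) + g ((((n : ℝ) ^ ((e : ℝ)⁻¹) : ℝ) : ℂ))⁻¹ = L} := by
  set w : ℕ → ℂ := fun n => (((n : ℝ) ^ ((e : ℝ)⁻¹) : ℝ) : ℂ) with hw
  set x : ℕ → Fin 2 → ℂ := fun n =>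
    (![2 * ↑π * I * (n : ℂ) + ℓu (w n)⁻¹, 2 * ↑π * I * (A.eval (w n) + g (w n)⁻¹) + ℓv (w n)⁻¹] : Fin 2 → ℂ)
    with hx
  show Set.Finite {n : ℕ | LinearIndependent ℚ (x n) ∧ ∃ L : ℤ, A.eval (w n) + g (w n)⁻¹ = L}
  obtain ⟨W', hW'd, hdim', hbr'⟩ := hW'
  -- the crux: finitely many independent exponential points on `W'`
  have hfin : Set.Finite {z : Fin 2 → ℂ | LinearIndependent ℚ z ∧ Sum.elim z (Complex.exp ∘ z) ∈ W'} :=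
    hcrux W' hW'd hdim'
  have hw_pow : ∀ n : ℕ, (w n) ^ e = (n : ℂ) := fun n => aoc_rayAbscissa_pow he n
  have hσmem : ∀ᶠ n : ℕ in atTop, 0 < ‖(w n)⁻¹‖ ∧ ‖(w n)⁻¹‖ < ρ :=
    aoc_eventually_rayPoint_mem_puncturedDisc he hρ
  have hσlim : Tendsto (fun n => (w n)⁻¹) atTop (𝓝 0) :=
    (aoc_tendsto_rayPoint_nhdsNE he).mono_right nhdsWithin_le_nhds
  have hbd : ∀ᶠ n : ℕ in atTop, ‖ℓu (w n)⁻¹‖ ≤ ‖ℓu 0‖ + 1 := by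
    have h := ((hu.continuousAt.tendsto).comp hσlim).norm
    exact (h.eventually (gt_mem_nhds (lt_add_one _))).mono fun n hn => hn.le
  -- a late hit is an independent exponential point of `W'`
  have hmem : ∀ᶠ n : ℕ in atTop, ∀ L : ℤ, A.eval (w n) + g (w n)⁻¹ = L → LinearIndependent ℚ (x n) →
      x n ∈ {z : Fin 2 → ℂ | LinearIndependent ℚ z ∧ Sum.elim z (Complex.exp ∘ z) ∈ W'} := by
    filter_upwards [hσmem] with n hn L hL hind
    refine ⟨hind, ?_⟩
    obtain ⟨hT1, hT2, h3, h4, h5, h6⟩ := hlink _ hn.1 hn.2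
    have hpt := hbr' _ hT1 hT2
    have hinv : ((w n)⁻¹)⁻¹ ^ e = (n : ℂ) := by rw [inv_inv, hw_pow]
    have h2pin : Complex.exp (2 * ↑π * I * (n : ℂ)) = 1 := by
      rw [show (2 * ↑π * I * (n : ℂ)) = (n : ℂ) * (2 * ↑π * I) by ring]
      exact Complex.exp_nat_mul_two_pi_mul_I n
    have h2piL : Complex.exp (2 * ↑π * I * (L : ℂ)) = 1 := by
      rw [show (2 * ↑π * I * (L : ℂ)) = (L : ℂ) * (2 * ↑π * I) by ring]
      exact Complex.exp_int_mul_two_pi_mul_I L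
    have hx0 : x n 0 = ((T (w n)⁻¹) ^ e)⁻¹ := by
      rw [h3, hinv]; simp [hx]
    have hx1 : x n 1 = Φ₁ (T (w n)⁻¹) / (T (w n)⁻¹) ^ N₀ := by
      rw [h4, inv_inv]; simp [hx]
    have he0 : Complex.exp (x n 0) = Complex.exp (ℓ₀ (T (w n)⁻¹)) := by
      have : x n 0 = 2 * ↑π * I * (n : ℂ) + ℓu (w n)⁻¹ := by simp [hx]
      rw [this, Complex.exp_add, h2pin, one_mul, h5]
    have he1 : Complex.exp (x n 1) = Complex.exp (ℓ₁ (T (w n)⁻¹)) := by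
      have : x n 1 = 2 * ↑π * I * (L : ℂ) + ℓv (w n)⁻¹ := by simp [hx, hL]
      rw [this, Complex.exp_add, h2piL, one_mul, h6]
    have hvec : Sum.elim (x n) (Complex.exp ∘ x n) =
        Sum.elim (![((T (w n)⁻¹) ^ e)⁻¹, Φ₁ (T (w n)⁻¹) / (T (w n)⁻¹) ^ N₀] : Fin 2 → ℂ)
          (![Complex.exp (ℓ₀ (T (w n)⁻¹)), Complex.exp (ℓ₁ (T (w n)⁻¹))] : Fin 2 → ℂ) := by
      funext i
      rcases i with i | i <;> fin_cases i
      · simpa using hx0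
      · simpa using hx1
      · simpa using he0
      · simpa using he1
    show Sum.elim (x n) (Complex.exp ∘ x n) ∈ W'
    rw [hvec]
    exact hpt
  -- the first coordinates of the finite set are bounded
  obtain ⟨M, hM⟩ := (hfin.image fun z => ‖z 0‖).bddAbove
  have hlate : ∀ᶠ n : ℕ in atTop, ¬ (LinearIndependent ℚ (x n) ∧ ∃ L : ℤ, A.eval (w n) + g (w n)⁻¹ = L) := by
    have hgrow : ∀ᶠ n : ℕ in atTop, M + (‖ℓu 0‖ + 1) < 2 * π * n := by
      have ht : Tendsto (fun n : ℕ => 2 * π * (n : ℝ)) atTop atTop :=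
        Tendsto.const_mul_atTop (by positivity) tendsto_natCast_atTop_atTop
      exact ht.eventually_gt_atTop _
    filter_upwards [hmem, hbd, hgrow] with n hn hb hg ⟨hind, L, hL⟩
    have hz := hn L hL hind
    have hle : ‖x n 0‖ ≤ M := hM ⟨x n, hz, rfl⟩
    have hx0 : x n 0 = 2 * ↑π * I * (n : ℂ) + ℓu (w n)⁻¹ := by simp [hx]
    have hnorm : 2 * π * n ≤ ‖x n 0‖ + ‖ℓu (w n)⁻¹‖ := by
      have h1 : ‖2 * ↑π * I * (n : ℂ)‖ = 2 * π * n := by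
        rw [norm_mul, norm_mul, norm_mul, Complex.norm_I, Complex.norm_real, Real.norm_eq_abs,
          abs_of_pos Real.pi_pos, Complex.norm_natCast]
        norm_num
      have h2 : (2 * ↑π * I * (n : ℂ)) = x n 0 - ℓu (w n)⁻¹ := by rw [hx0]; ring
      rw [← h1, h2]
      exact norm_sub_le _ _
    linarith
  rw [← Nat.cofinite_eq_atTop, Filter.eventually_cofinite] at hlate
  simpa only [not_not] using hlate

/-- **A3 is an instance of the crux**: `SparsityTwo → stub_wildCuspAtom` (statement verbatim). -/
theorem wildCuspAtom_of_sparsityTwo :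
    Summit.Schanuel.Schanuel.Theses.RigidCore.SparsityTwo →
    ∀ (e N₀ : ℕ) (A : Polynomial ℂ) (g ℓu ℓv T ℓ₀ ℓ₁ Φ₁ : ℂ → ℂ) (ρ r : ℝ),
      let w : ℕ → ℂ := fun n => (((n : ℝ) ^ ((e : ℝ)⁻¹) : ℝ) : ℂ);
      let x : ℕ → Fin 2 → ℂ := fun n =>
        ![2 * ↑π * I * (n : ℂ) + ℓu (w n)⁻¹, 2 * ↑π * I * (A.eval (w n) + g (w n)⁻¹) + ℓv (w n)⁻¹];
      0 < e → 0 < ρ → 0 < r → AnalyticAt ℂ g 0 → g 0 = 0 → AnalyticAt ℂ ℓu 0 → AnalyticAt ℂ ℓv 0 →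
      AnalyticAt ℂ T 0 → T 0 = 0 → AnalyticAt ℂ ℓ₀ 0 → AnalyticAt ℂ ℓ₁ 0 → AnalyticAt ℂ Φ₁ 0 →
      (¬ ∃ P : MvPolynomial (Fin 2) ℂ, P ≠ 0 ∧
          ∀ᶠ z in 𝓝 (0 : ℂ), MvPolynomial.eval ![z, g z] P = 0) →
      (¬ ∃ (q : Polynomial ℚ) (c : ℂ), ∀ N : ℕ,
          A.eval (w N) = (q.map (algebraMap ℚ ℂ)).eval (N : ℂ) + c) →
      ((∀ k : ℕ, (A.coeff k).im = 0) ∧ ∀ᶠ u : ℝ in 𝓝[>] 0, (g (u : ℂ)).im = 0) →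
      (∀ ε : ℝ, 0 < ε → ∃ᶠ X : ℕ in atTop,
        (Nat.card {N : ℕ | N ≤ X ∧ ∃ L : ℤ, A.eval (w N) + g (w N)⁻¹ = L} : ℝ) ≤ ε * Real.log X) →
      (∀ σ : ℂ, 0 < ‖σ‖ → ‖σ‖ < ρ → 0 < ‖T σ‖ ∧ ‖T σ‖ < r ∧
        ((T σ) ^ e)⁻¹ = 2 * ↑π * I * σ⁻¹ ^ e + ℓu σ ∧
        Φ₁ (T σ) / (T σ) ^ N₀ = 2 * ↑π * I * (A.eval σ⁻¹ + g σ) + ℓv σ ∧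
        ℓ₀ (T σ) = ℓu σ ∧ ℓ₁ (T σ) = ℓv σ) →
      (∃ W' : Set (Fin 2 ⊕ Fin 2 → ℂ), IsDefinedOver (⊥ : Subfield ℂ) W' ∧ zariskiDim ℂ W' < 2 ∧
        ∀ t : ℂ, 0 < ‖t‖ → ‖t‖ < r →
          Sum.elim (![(t ^ e)⁻¹, Φ₁ t / t ^ N₀] : Fin 2 → ℂ)
            (![Complex.exp (ℓ₀ t), Complex.exp (ℓ₁ t)] : Fin 2 → ℂ) ∈ W') →
      (∃ R : MvPolynomial (Fin 2) ℚ, R ≠ 0 ∧ ∀ t : ℂ, 0 < ‖t‖ → ‖t‖ < r →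
        MvPolynomial.aeval ![(t ^ e)⁻¹, Complex.exp (ℓ₀ t)] R = 0) →
      (∃ R : MvPolynomial (Fin 2) ℚ, R ≠ 0 ∧ ∀ t : ℂ, 0 < ‖t‖ → ‖t‖ < r →
        MvPolynomial.aeval ![(t ^ e)⁻¹, Complex.exp (ℓ₁ t)] R = 0) →
      (∃ R : MvPolynomial (Fin 2) ℚ, R ≠ 0 ∧ ∀ t : ℂ, 0 < ‖t‖ → ‖t‖ < r →
        MvPolynomial.aeval ![(t ^ e)⁻¹, Φ₁ t / t ^ N₀] R = 0) →
      (∃ R : MvPolynomial (Fin 2) ℚ, R ≠ 0 ∧ ∀ t : ℂ, 0 < ‖t‖ → ‖t‖ < r →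
        MvPolynomial.aeval ![Φ₁ t / t ^ N₀, Complex.exp (ℓ₀ t)] R = 0) →
      (∃ R : MvPolynomial (Fin 2) ℚ, R ≠ 0 ∧ ∀ t : ℂ, 0 < ‖t‖ → ‖t‖ < r →
        MvPolynomial.aeval ![Φ₁ t / t ^ N₀, Complex.exp (ℓ₁ t)] R = 0) →
      (∃ R : MvPolynomial (Fin 2) ℚ, R ≠ 0 ∧ ∀ t : ℂ, 0 < ‖t‖ → ‖t‖ < r →
        MvPolynomial.aeval ![Complex.exp (ℓ₀ t), Complex.exp (ℓ₁ t)] R = 0) →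
      (∀ n : ℕ, IsAlgebraic ℚ (iteratedDeriv n Φ₁ 0)) →
      IsAlgebraic ℚ (Complex.exp (ℓ₀ 0)) → IsAlgebraic ℚ (Complex.exp (ℓ₁ 0)) →
      (∀ n : ℕ, 0 < n → IsAlgebraic ℚ (iteratedDeriv n ℓ₀ 0)) →
      (∀ n : ℕ, 0 < n → IsAlgebraic ℚ (iteratedDeriv n ℓ₁ 0)) →
      (¬ ∃ (β : ℂ) (G : ℂ → ℂ), AnalyticAt ℂ G 0 ∧
          ∀ t : ℂ, 0 < ‖t‖ → ‖t‖ < r → Φ₁ t / t ^ N₀ = β * (t ^ e)⁻¹ + G t) →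
      (¬ ∀ᶠ t in 𝓝 (0 : ℂ), ℓ₀ t = ℓ₀ 0 ∧ ℓ₁ t = ℓ₁ 0) →
      Set.Finite {n : ℕ | LinearIndependent ℚ (x n) ∧ ∃ L : ℤ, A.eval (w n) + g (w n)⁻¹ = L} := by
  intro hcrux e N₀ A g ℓu ℓv T ℓ₀ ℓ₁ Φ₁ ρ r w x he hρ _ _ _ hu _ _ _ _ _ _ _ _ _ _ hlink hW' _ _ _ _ _ _ _ _ _ _ _ _ _
  exact rayHits_finite_of_sparsityTwo hcrux he hρ hu hlink hW'

/-- **A2 is an instance of the crux**: `SparsityTwo → stub_inhomogeneousCuspAtom` (statement verbatim). -/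
theorem inhomogeneousCuspAtom_of_sparsityTwo :
    Summit.Schanuel.Schanuel.Theses.RigidCore.SparsityTwo →
    ∀ (e N₀ : ℕ) (A : Polynomial ℂ) (g ℓu ℓv T ℓ₀ ℓ₁ Φ₁ G : ℂ → ℂ) (ρ r : ℝ) (β : ℂ),
      let w : ℕ → ℂ := fun n => (((n : ℝ) ^ ((e : ℝ)⁻¹) : ℝ) : ℂ);
      let x : ℕ → Fin 2 → ℂ := fun n =>
        ![2 * ↑π * I * (n : ℂ) + ℓu (w n)⁻¹, 2 * ↑π * I * (A.eval (w n) + g (w n)⁻¹) + ℓv (w n)⁻¹];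
      0 < e → 0 < ρ → 0 < r → AnalyticAt ℂ g 0 → g 0 = 0 → AnalyticAt ℂ ℓu 0 → AnalyticAt ℂ ℓv 0 →
      AnalyticAt ℂ T 0 → T 0 = 0 → AnalyticAt ℂ ℓ₀ 0 → AnalyticAt ℂ ℓ₁ 0 → AnalyticAt ℂ Φ₁ 0 →
      (¬ ∃ P : MvPolynomial (Fin 2) ℂ, P ≠ 0 ∧
          ∀ᶠ z in 𝓝 (0 : ℂ), MvPolynomial.eval ![z, g z] P = 0) →
      (¬ ∃ (q : Polynomial ℚ) (c : ℂ), ∀ N : ℕ,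
          A.eval (w N) = (q.map (algebraMap ℚ ℂ)).eval (N : ℂ) + c) →
      ((∀ k : ℕ, (A.coeff k).im = 0) ∧ ∀ᶠ u : ℝ in 𝓝[>] 0, (g (u : ℂ)).im = 0) →
      (∀ ε : ℝ, 0 < ε → ∃ᶠ X : ℕ in atTop,
        (Nat.card {N : ℕ | N ≤ X ∧ ∃ L : ℤ, A.eval (w N) + g (w N)⁻¹ = L} : ℝ) ≤ ε * Real.log X) →
      (∀ σ : ℂ, 0 < ‖σ‖ → ‖σ‖ < ρ → 0 < ‖T σ‖ ∧ ‖T σ‖ < r ∧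
        ((T σ) ^ e)⁻¹ = 2 * ↑π * I * σ⁻¹ ^ e + ℓu σ ∧
        Φ₁ (T σ) / (T σ) ^ N₀ = 2 * ↑π * I * (A.eval σ⁻¹ + g σ) + ℓv σ ∧
        ℓ₀ (T σ) = ℓu σ ∧ ℓ₁ (T σ) = ℓv σ) →
      (∃ W' : Set (Fin 2 ⊕ Fin 2 → ℂ), IsDefinedOver (⊥ : Subfield ℂ) W' ∧ zariskiDim ℂ W' < 2 ∧
        ∀ t : ℂ, 0 < ‖t‖ → ‖t‖ < r →
          Sum.elim (![(t ^ e)⁻¹, Φ₁ t / t ^ N₀] : Fin 2 → ℂ)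
            (![Complex.exp (ℓ₀ t), Complex.exp (ℓ₁ t)] : Fin 2 → ℂ) ∈ W') →
      (∃ R : MvPolynomial (Fin 2) ℚ, R ≠ 0 ∧ ∀ t : ℂ, 0 < ‖t‖ → ‖t‖ < r →
        MvPolynomial.aeval ![(t ^ e)⁻¹, Complex.exp (ℓ₀ t)] R = 0) →
      (∃ R : MvPolynomial (Fin 2) ℚ, R ≠ 0 ∧ ∀ t : ℂ, 0 < ‖t‖ → ‖t‖ < r →
        MvPolynomial.aeval ![(t ^ e)⁻¹, Complex.exp (ℓ₁ t)] R = 0) →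
      (∃ R : MvPolynomial (Fin 2) ℚ, R ≠ 0 ∧ ∀ t : ℂ, 0 < ‖t‖ → ‖t‖ < r →
        MvPolynomial.aeval ![(t ^ e)⁻¹, Φ₁ t / t ^ N₀] R = 0) →
      (∃ R : MvPolynomial (Fin 2) ℚ, R ≠ 0 ∧ ∀ t : ℂ, 0 < ‖t‖ → ‖t‖ < r →
        MvPolynomial.aeval ![Φ₁ t / t ^ N₀, Complex.exp (ℓ₀ t)] R = 0) →
      (∃ R : MvPolynomial (Fin 2) ℚ, R ≠ 0 ∧ ∀ t : ℂ, 0 < ‖t‖ → ‖t‖ < r →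
        MvPolynomial.aeval ![Φ₁ t / t ^ N₀, Complex.exp (ℓ₁ t)] R = 0) →
      (∃ R : MvPolynomial (Fin 2) ℚ, R ≠ 0 ∧ ∀ t : ℂ, 0 < ‖t‖ → ‖t‖ < r →
        MvPolynomial.aeval ![Complex.exp (ℓ₀ t), Complex.exp (ℓ₁ t)] R = 0) →
      (∀ n : ℕ, IsAlgebraic ℚ (iteratedDeriv n Φ₁ 0)) →
      IsAlgebraic ℚ (Complex.exp (ℓ₀ 0)) → IsAlgebraic ℚ (Complex.exp (ℓ₁ 0)) →
      (∀ n : ℕ, 0 < n → IsAlgebraic ℚ (iteratedDeriv n ℓ₀ 0)) →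
      (∀ n : ℕ, 0 < n → IsAlgebraic ℚ (iteratedDeriv n ℓ₁ 0)) →
      AnalyticAt ℂ G 0 → (∀ t : ℂ, 0 < ‖t‖ → ‖t‖ < r → Φ₁ t / t ^ N₀ = β * (t ^ e)⁻¹ + G t) →
      IsAlgebraic ℚ β → (∀ n : ℕ, IsAlgebraic ℚ (iteratedDeriv n G 0)) →
      (∀ r' : ℚ, (r' : ℂ) ≠ β) →
      (¬ ∀ᶠ t in 𝓝 (0 : ℂ), ℓ₀ t = ℓ₀ 0 ∧ ℓ₁ t = ℓ₁ 0) →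
      ((∃ q : ℕ, 0 < q ∧ Complex.exp (ℓ₀ 0) ^ q = 1 ∧ Complex.exp (ℓ₁ 0) ^ q = 1) → G 0 ≠ 0) →
      Set.Finite {n : ℕ | LinearIndependent ℚ (x n) ∧ ∃ L : ℤ, A.eval (w n) + g (w n)⁻¹ = L} := by
  intro hcrux e N₀ A g ℓu ℓv T ℓ₀ ℓ₁ Φ₁ G ρ r β w x he hρ _ _ _ hu _ _ _ _ _ _ _ _ _ _ hlink hW' _ _ _ _ _ _ _ _ _ _ _ _ _ _ _ _ _ _
  exact rayHits_finite_of_sparsityTwo hcrux he hρ hu hlink hW'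

/-- **A1 is an instance of the crux**: `SparsityTwo → stub_linearCuspAtom` (statement verbatim). -/
theorem linearCuspAtom_of_sparsityTwo :
    Summit.Schanuel.Schanuel.Theses.RigidCore.SparsityTwo →
    ∀ (e N₀ : ℕ) (A : Polynomial ℂ) (g ℓu ℓv T ℓ₀ ℓ₁ Φ₁ G : ℂ → ℂ) (ρ r : ℝ) (β : ℂ) (q : ℕ) (m₀ m₁ : ℤ),
      let w : ℕ → ℂ := fun n => (((n : ℝ) ^ ((e : ℝ)⁻¹) : ℝ) : ℂ);
      let x : ℕ → Fin 2 → ℂ := fun n =>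
        ![2 * ↑π * I * (n : ℂ) + ℓu (w n)⁻¹, 2 * ↑π * I * (A.eval (w n) + g (w n)⁻¹) + ℓv (w n)⁻¹];
      0 < e → 0 < ρ → 0 < r → AnalyticAt ℂ g 0 → g 0 = 0 → AnalyticAt ℂ ℓu 0 → AnalyticAt ℂ ℓv 0 →
      AnalyticAt ℂ T 0 → T 0 = 0 → AnalyticAt ℂ ℓ₀ 0 → AnalyticAt ℂ ℓ₁ 0 → AnalyticAt ℂ Φ₁ 0 →
      (¬ ∃ P : MvPolynomial (Fin 2) ℂ, P ≠ 0 ∧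
          ∀ᶠ z in 𝓝 (0 : ℂ), MvPolynomial.eval ![z, g z] P = 0) →
      (¬ ∃ (q : Polynomial ℚ) (c : ℂ), ∀ N : ℕ,
          A.eval (w N) = (q.map (algebraMap ℚ ℂ)).eval (N : ℂ) + c) →
      ((∀ k : ℕ, (A.coeff k).im = 0) ∧ ∀ᶠ u : ℝ in 𝓝[>] 0, (g (u : ℂ)).im = 0) →
      (∀ ε : ℝ, 0 < ε → ∃ᶠ X : ℕ in atTop,
        (Nat.card {N : ℕ | N ≤ X ∧ ∃ L : ℤ, A.eval (w N) + g (w N)⁻¹ = L} : ℝ) ≤ ε * Real.log X) →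
      (∀ σ : ℂ, 0 < ‖σ‖ → ‖σ‖ < ρ → 0 < ‖T σ‖ ∧ ‖T σ‖ < r ∧
        ((T σ) ^ e)⁻¹ = 2 * ↑π * I * σ⁻¹ ^ e + ℓu σ ∧
        Φ₁ (T σ) / (T σ) ^ N₀ = 2 * ↑π * I * (A.eval σ⁻¹ + g σ) + ℓv σ ∧
        ℓ₀ (T σ) = ℓu σ ∧ ℓ₁ (T σ) = ℓv σ) →
      (∃ W' : Set (Fin 2 ⊕ Fin 2 → ℂ), IsDefinedOver (⊥ : Subfield ℂ) W' ∧ zariskiDim ℂ W' < 2 ∧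
        ∀ t : ℂ, 0 < ‖t‖ → ‖t‖ < r →
          Sum.elim (![(t ^ e)⁻¹, Φ₁ t / t ^ N₀] : Fin 2 → ℂ)
            (![Complex.exp (ℓ₀ t), Complex.exp (ℓ₁ t)] : Fin 2 → ℂ) ∈ W') →
      (∃ R : MvPolynomial (Fin 2) ℚ, R ≠ 0 ∧ ∀ t : ℂ, 0 < ‖t‖ → ‖t‖ < r →
        MvPolynomial.aeval ![(t ^ e)⁻¹, Complex.exp (ℓ₀ t)] R = 0) →
      (∃ R : MvPolynomial (Fin 2) ℚ, R ≠ 0 ∧ ∀ t : ℂ, 0 < ‖t‖ → ‖t‖ < r →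
        MvPolynomial.aeval ![(t ^ e)⁻¹, Complex.exp (ℓ₁ t)] R = 0) →
      (∃ R : MvPolynomial (Fin 2) ℚ, R ≠ 0 ∧ ∀ t : ℂ, 0 < ‖t‖ → ‖t‖ < r →
        MvPolynomial.aeval ![(t ^ e)⁻¹, Φ₁ t / t ^ N₀] R = 0) →
      (∃ R : MvPolynomial (Fin 2) ℚ, R ≠ 0 ∧ ∀ t : ℂ, 0 < ‖t‖ → ‖t‖ < r →
        MvPolynomial.aeval ![Φ₁ t / t ^ N₀, Complex.exp (ℓ₀ t)] R = 0) →
      (∃ R : MvPolynomial (Fin 2) ℚ, R ≠ 0 ∧ ∀ t : ℂ, 0 < ‖t‖ → ‖t‖ < r →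
        MvPolynomial.aeval ![Φ₁ t / t ^ N₀, Complex.exp (ℓ₁ t)] R = 0) →
      (∃ R : MvPolynomial (Fin 2) ℚ, R ≠ 0 ∧ ∀ t : ℂ, 0 < ‖t‖ → ‖t‖ < r →
        MvPolynomial.aeval ![Complex.exp (ℓ₀ t), Complex.exp (ℓ₁ t)] R = 0) →
      (∀ n : ℕ, IsAlgebraic ℚ (iteratedDeriv n Φ₁ 0)) →
      IsAlgebraic ℚ (Complex.exp (ℓ₀ 0)) → IsAlgebraic ℚ (Complex.exp (ℓ₁ 0)) →
      (∀ n : ℕ, 0 < n → IsAlgebraic ℚ (iteratedDeriv n ℓ₀ 0)) →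
      (∀ n : ℕ, 0 < n → IsAlgebraic ℚ (iteratedDeriv n ℓ₁ 0)) →
      AnalyticAt ℂ G 0 → (∀ t : ℂ, 0 < ‖t‖ → ‖t‖ < r → Φ₁ t / t ^ N₀ = β * (t ^ e)⁻¹ + G t) →
      IsAlgebraic ℚ β → (∀ n : ℕ, IsAlgebraic ℚ (iteratedDeriv n G 0)) →
      (∀ r' : ℚ, (r' : ℂ) ≠ β) →
      β.im = 0 → 0 < q → (q : ℂ) * ℓ₀ 0 = 2 * ↑π * I * (m₀ : ℂ) → (q : ℂ) * ℓ₁ 0 = 2 * ↑π * I * (m₁ : ℂ) →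
      G 0 = 0 →
      (¬ ∀ᶠ t in 𝓝 (0 : ℂ), ℓ₀ t = ℓ₀ 0 ∧ ℓ₁ t = ℓ₁ 0) →
      (∃ j : ℕ, j ≤ e ∧ j < e * ((minpoly ℚ β).natDegree - 1) ∧
        (∀ i : ℕ, i < j → iteratedDeriv i (fun t => β * (ℓ₀ t - ℓ₀ 0) - (ℓ₁ t - ℓ₁ 0) + G t) 0 = 0) ∧
        iteratedDeriv j (fun t => β * (ℓ₀ t - ℓ₀ 0) - (ℓ₁ t - ℓ₁ 0) + G t) 0 ≠ 0) →
      Set.Finite {n : ℕ | LinearIndependent ℚ (x n) ∧ ∃ L : ℤ, A.eval (w n) + g (w n)⁻¹ = L} := by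
  intro hcrux e N₀ A g ℓu ℓv T ℓ₀ ℓ₁ Φ₁ G ρ r β q m₀ m₁ w x he hρ _ _ _ hu _ _ _ _ _ _ _ _ _ _ hlink hW' _ _ _ _ _ _ _ _ _ _ _ _ _ _ _
    _ _ _ _ _ _ _ _
  exact rayHits_finite_of_sparsityTwo hcrux he hρ hu hlink hW'

end Summit.Schanuel.Schanuel.Cruxes.SparsityTwo.CuspGermSchneiderSparsity
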